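import Summits.QuantumFields.BalabanUV.Gaps.D4NodeEConvergence
import Literature.MathematicalPhysics.QuantumFieldTheory.Balaban1983to89.Beta.RemainderKernelPeriodised
import Literature.MathematicalPhysics.QuantumFieldTheory.Balaban1983to89.Beta.RemainderKernelDecay

/-!
# `BalabanUV.Gaps.D4NodeEJunctionPeriodised` — ROW (D4), NODE E: the SUPPLIER-SIDE JUNCTION of the gaps cell's (1.21) lemma
# `Gaps.D4NodeEConvergence.hconv_of_periodisedColumns` (reading (a), hypothesis `hid`) with the β sub-cell's ENTRY SHAPE
# `Beta.RemainderKernelPeriodised.hker_of_entry` on the (4.4)-space MODEL, and its (182)-composite corollary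

HONEST FRAMING (page 1, cell contract).  WHAT THIS IS: two [folklore] junction lemmas, no new idea.  (1)
`hconv_of_periodisedColumns_of_entry`: on the (4.4)-space MODEL of row (D4) (`Wn n := TPt d (N n·M) → ℂ` with the sup norm; a
(190)-socket `D` whose (4.35) test vector is the restricted kernel column of a torus operator family `dH n` — the
computation rule `hrule` exposed by `Beta.RemainderDecay190SupNorm.exists_data190_of_sectG_blocks_supNorm`), if every `dH n`
acts ENTRYWISE as the periodisation of ONE ℤ^d kernel `S` (`hent`, [Balaban1984PropagatorsI] p. 36 *"relating G on the torus
to G on the whole lattice in the usual way"*) that is periodic under every `N n·M` and decays exponentially, then the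
hypothesis `hid` of `hconv_of_periodisedColumns` HOLDS with `Φ Y := id`, `r n Y := restrictCLM (N n·M) (e Y)` (window sites
`e Y i` inside the cubes of `Y`), `S Y := S` — it is `hker_of_entry` composed with ONE `funext` over the window sites — and
the (1.21) convergence follows BY `hconv_of_periodisedColumns` (the junction located by seat g1-p1 GEN 9, R-gapsg1p1-g9-1,
kernel-checked here).  (2) `hconv_of_periodisedColumns_of_pieces182`: the same for `dH n` assembled by [Balaban1985Variational]
(182) from four operator families acting entrywise as the periodisations of four ℤ^d kernels decaying at a common rate and
periodic under every torus period (`Beta.RemainderKernelPeriodised.entry_eq182` + `Beta.RemainderKernelDecay.decay₂_eq182`):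
the limit test vector is the window column of `k₁₈₂ := (a₀ + h₀) + (−1)·(h ∘ (𝔡 ∘ (a₀ + h₀)))`.  WHAT THIS IS NOT: not an
instance of NODE O (no operator of Bałaban's is constructed: `dH`, the pieces, `S`, `e` are parameters), not (D4), not an
estimate; nothing of Bałaban's papers asserted or discharged; NOT `BetaPertH`, NOT the continuum limit, NOT Clay.  Row D4
class UNCHANGED (instance 0∕1; critical-path width 0 = NODE O; D4 DISCHARGE NO DATE).
HONEST DEPENDENCY (verbatim): continuum YM on T⁴ ⇐ BetaPertH ∧ nine spine estimates (0/9 proved); BetaPertH ⇐ (D1) ∧ (D4) ∧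
CAP+tail; G-an2-4 gates asym, D1 and NE2/3/4.

WHY A `Gaps/` FILE.  The abstract (1.21) lemma lives in the gaps cell's `Gaps.D4NodeEConvergence` (seat g1-p1 gen 3, p345472);
the entry shape and the (182) algebra live in the β sub-cell's Literature files (`Beta.RemainderKernelPeriodised` p368841,
`Beta.RemainderKernelDecay` p368916, unit `b2b-balaban-beta-an4` gen 95); a Literature file cannot import `Summits.*`, so the
junction BY NAME sits here.  The β sub-cell's own model-side twin that bypasses `hid` is
`Beta.RemainderDecay190SupNormLimit.hconv_restrictCLM_of_periodised` (same conclusion, proved from the engine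
`Beta.RemainderLocalitySockets.hconv_periodise₂_cubes` directly); this file certifies that the two cells' interfaces FIT.

ABSOLUTE RULE (cell charter, verbatim): «No internally-minted statement may enter as a cited fact. Every hypothesis is
either kernel-proved in this package or a verbatim quotation of a PUBLISHED theorem with page reference.»  No `def`, no
`def … : Prop`, nothing cited as mathematics, 0 sorry, axioms ⊆ the standard trio.  Provenance: unit `b2b-balaban-beta-an4`
gen 96 (row (D4) OWNER; OFFER O-an4-g96-1 to seat g1-p1 GEN 9, first refusal honoured), 2026-08-23; imports
`Gaps.D4NodeEConvergence` + `Beta.RemainderKernelPeriodised` + `Beta.RemainderKernelDecay` only; no existing file touched.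
-/

noncomputable section

open Literature.MathematicalPhysics.QuantumFieldTheory.Balaban1983to89
open Literature.MathematicalPhysics.QuantumFieldTheory.Balaban1983to89.B13ScaleTransfer (Pt)
open Literature.MathematicalPhysics.QuantumFieldTheory.Balaban1983to89.TreeLengthTorus (TPt TDom proj)
open Literature.MathematicalPhysics.QuantumFieldTheory.Balaban1983to89.B12Decay510Lattice (cubeOf)
open Literature.MathematicalPhysics.QuantumFieldTheory.Balaban1983to89.B12Decay510Torus (tcubeOf proj_cubeOf_of_proj_eq)
open Literature.MathematicalPhysics.QuantumFieldTheory.Balaban1983to89.B11SectG (Eq182)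
open Literature.MathematicalPhysics.QuantumFieldTheory.Balaban1983to89.Beta.RemainderLimitTorus (LDom tproj tproj_val)
open Literature.MathematicalPhysics.QuantumFieldTheory.Balaban1983to89.Beta.RemainderDecay190 (Data190 Consts190)
open Literature.MathematicalPhysics.QuantumFieldTheory.Balaban1983to89.B12Sec2to5 (l1)
open Literature.MathematicalPhysics.QuantumFieldTheory.Balaban1983to89.Beta
  (Kernel₂ IsPeriodic₂ Decay₂ compKer periodise₂)
open Literature.MathematicalPhysics.QuantumFieldTheory.Balaban1983to89.Beta.RemainderLocalitySockets
  (restrictCLM restrictCLM_apply)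
open Literature.MathematicalPhysics.QuantumFieldTheory.Balaban1983to89.Beta.RemainderKernelPeriodised
  (entry_eq182 hker_of_entry)
open Literature.MathematicalPhysics.QuantumFieldTheory.Balaban1983to89.Beta.RemainderKernelDecay (decay₂_eq182)
open Summit.QuantumFields.BalabanUV.Gaps.D4NodeEConvergence (hconv_of_periodisedColumns)
open Filter
open scoped Topology

namespace Summit.QuantumFields.BalabanUV.Gaps.D4NodeEJunctionPeriodised

variable {d : ℕ} {M : ℕ} [NeZero M] {q : Consts190}

/-! ## §1 The junction: `hid` of reading (a) from the entry shape, on the (4.4)-space model -/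

/-- [folklore] **THE SUPPLIER-SIDE JUNCTION OF `hconv_of_periodisedColumns` WITH THE ENTRY SHAPE.**  On the (4.4)-space
model (`Wn n := TPt d (N n·M) → ℂ`; a (190)-socket `D` with the (4.35) computation rule `hrule` for a torus operator family
`dH n`), if every `dH n` acts entrywise as the periodisation of ONE ℤ^d kernel `S` (`hent`), `S` is periodic under every
`N n·M` (`hS`) and decays (`hdec`, `δ > 0`), the window sites `e Y i` lie in the cubes of `Y` (`he`) and `N n → ∞`, then the
(1.21) convergence field holds with the limit test vector `(S (e Y i) x)_i` — PROVED BY the gaps cell's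
`D4NodeEConvergence.hconv_of_periodisedColumns` with `Φ Y := id`, `r n Y := restrictCLM (N n·M) (e Y)`, `S Y := S`, its `hid`
being `Beta.RemainderKernelPeriodised.hker_of_entry` after one `funext` over the window sites (and `hrule`). -/
theorem hconv_of_periodisedColumns_of_entry {N : ℕ → ℕ} [∀ n, NeZero (N n)]
    (D : Data190 d M N (fun n => TPt d (N n * M) → ℂ) q)
    (dH : (n : ℕ) → (TPt d (N n * M) → ℝ) →ₗ[ℝ] (TPt d (N n * M) → ℝ))
    (hrule : ∀ (n : ℕ) (X : TDom d (N n)) (x : TPt d (N n * M)),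
      D.hn n X x = fun x' : TPt d (N n * M) =>
        if tcubeOf (N n) M x' ∈ X.1 then ((dH n (Pi.single x (1 : ℝ)) x' : ℝ) : ℂ) else 0)
    (hN : Tendsto N atTop atTop) {S : Kernel₂ d} {C δ : ℝ}
    (hent : ∀ n (a b : TPt d (N n * M)), dH n (Pi.single b 1) a = periodise₂ (N n * M) S a b)
    (hS : ∀ n, IsPeriodic₂ (N n * M) S) (hdec : Decay₂ S C δ) (hδ : 0 < δ)
    {ι : LDom d → Type} [∀ Y, Fintype (ι Y)] (e : (Y : LDom d) → ι Y → Pt d)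
    (he : ∀ Y i, cubeOf M (e Y i) ∈ Y.1) :
    ∀ (Y : LDom d) (x : Pt d),
      Tendsto (fun n => restrictCLM (N n * M) (e Y) (D.hn n (tproj (N n) Y) (proj (N n * M) x))) atTop
        (𝓝 fun i => (S (e Y i) x : ℂ)) := by
  -- the entry shape IS the letter `hker` (β sub-cell, generation 95)
  have hker := hker_of_entry dH hent e
  -- the cube of the residue of a window site is a cube of `tproj Y`
  have hmem : ∀ (Y : LDom d) (n : ℕ) (i : ι Y), tcubeOf (N n) M (proj (N n * M) (e Y i)) ∈ (tproj (N n) Y).1 :=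
    fun Y n i => by
      rw [tproj_val, ← proj_cubeOf_of_proj_eq (N := N n) (M := M) (P := e Y i) rfl]
      exact Finset.mem_image_of_mem _ (he Y i)
  -- the gaps cell's reading (a) with `Φ := id`, `r n Y := restrictCLM`, `S Y := S`; `hid` = `hker` after one `funext`
  exact hconv_of_periodisedColumns D (V := fun Y => ι Y → ℂ) (fun n Y => restrictCLM (N n * M) (e Y))
    (fun Y x => fun i => (S (e Y i) x : ℂ)) hN (S := fun _ => S) (fun _ n => hS n) (fun _ => hdec) hδ e
    (fun Y => ContinuousLinearMap.id ℂ (ι Y → ℂ))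
    (fun Y x n => by
      rw [ContinuousLinearMap.id_apply]
      funext i
      rw [restrictCLM_apply, restrictCLM_apply, hrule]
      dsimp only
      rw [if_pos (hmem Y n i), hker])
    (fun Y x => by rw [ContinuousLinearMap.id_apply])

/-! ## §2 The same for the (182)-composite of four periodised decaying pieces -/

/-- [folklore] **THE JUNCTION FOR δ𝐇∕δB ASSEMBLED BY (182) FROM FOUR PERIODISED DECAYING PIECES.**  If the four operators
`𝔄₀ n`, `H₀ n`, `H n`, `𝔇 n` on every torus act entrywise as the periodisations of ℤ^d kernels `a₀`, `h₀`, `h`, `𝔡`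
decaying at a common rate `δ₀ > 0` and periodic under every `N n·M`, and `dH n` is given by (182), then — on the (4.4)-space
model with the (4.35) rule — the restricted test vectors converge to the window column of
`k₁₈₂ := (a₀ + h₀) + (−1)·(h ∘ (𝔡 ∘ (a₀ + h₀)))`: §1 fed by `Beta.RemainderKernelPeriodised.entry_eq182` (entry shape and
joint periodicity of the composite; row bounds from the decay) and `Beta.RemainderKernelDecay.decay₂_eq182` (its decay at
rate `δ₀∕4`). -/
theorem hconv_of_periodisedColumns_of_pieces182 {N : ℕ → ℕ} [∀ n, NeZero (N n)]
    (D : Data190 d M N (fun n => TPt d (N n * M) → ℂ) q)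
    (dH A0 H0 Hk Dfr : (n : ℕ) → (TPt d (N n * M) → ℝ) →ₗ[ℝ] (TPt d (N n * M) → ℝ))
    (hrule : ∀ (n : ℕ) (X : TDom d (N n)) (x : TPt d (N n * M)),
      D.hn n X x = fun x' : TPt d (N n * M) =>
        if tcubeOf (N n) M x' ∈ X.1 then ((dH n (Pi.single x (1 : ℝ)) x' : ℝ) : ℂ) else 0)
    (hN : Tendsto N atTop atTop)
    {a₀ h₀ h 𝔡 : Kernel₂ d} {Ca Ch₀ Ch Cd δ₀ : ℝ}
    (ha : Decay₂ a₀ Ca δ₀) (hh₀ : Decay₂ h₀ Ch₀ δ₀) (hh : Decay₂ h Ch δ₀) (hd : Decay₂ 𝔡 Cd δ₀) (hδ₀ : 0 < δ₀)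
    (pa : ∀ n, IsPeriodic₂ (N n * M) a₀) (ph₀ : ∀ n, IsPeriodic₂ (N n * M) h₀) (ph : ∀ n, IsPeriodic₂ (N n * M) h)
    (pd : ∀ n, IsPeriodic₂ (N n * M) 𝔡)
    (h182 : ∀ n, Eq182 (dH n) (A0 n) (H0 n) (Hk n) (Dfr n))
    (hA0 : ∀ n (a b : TPt d (N n * M)), A0 n (Pi.single b 1) a = periodise₂ (N n * M) a₀ a b)
    (hH0 : ∀ n (a b : TPt d (N n * M)), H0 n (Pi.single b 1) a = periodise₂ (N n * M) h₀ a b)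
    (hHk : ∀ n (a b : TPt d (N n * M)), Hk n (Pi.single b 1) a = periodise₂ (N n * M) h a b)
    (hDfr : ∀ n (a b : TPt d (N n * M)), Dfr n (Pi.single b 1) a = periodise₂ (N n * M) 𝔡 a b)
    {ι : LDom d → Type} [∀ Y, Fintype (ι Y)] (e : (Y : LDom d) → ι Y → Pt d)
    (he : ∀ Y i, cubeOf M (e Y i) ∈ Y.1) :
    ∀ (Y : LDom d) (x : Pt d),
      Tendsto (fun n => restrictCLM (N n * M) (e Y) (D.hn n (tproj (N n) Y) (proj (N n * M) x))) atTop
        (𝓝 fun i => (((a₀ + h₀) + fun x y => (-1) * compKer h (compKer 𝔡 (a₀ + h₀)) x y) (e Y i) x : ℂ)) := by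
  have E := fun n => entry_eq182 (h182 n) (hA0 n) (hH0 n) (hHk n) (hDfr n) (pa n) (ph₀ n) (ph n) (pd n)
    (ha.rowBound hδ₀) (hh₀.rowBound hδ₀) (hh.rowBound hδ₀) (hd.rowBound hδ₀)
  exact hconv_of_periodisedColumns_of_entry D dH hrule hN (fun n a b => (E n).1 a b) (fun n => (E n).2.1)
    (decay₂_eq182 ha hh₀ hh hd hδ₀) (by positivity) e he

end Summit.QuantumFields.BalabanUV.Gaps.D4NodeEJunctionPeriodised

end
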